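import Summits.QuantumFields.BalabanUV.Beta.GAN24.StaircaseFaces

/-!
# `BalabanUV.Beta.GAN24.StaircasePairs` — binder row G-an2-4 / (CONV-C), CT-ROUTE (owner's design `gen17/CT-ROUTE-v1.md`, refined `gen18/CT3-MECHANISM.md`
# v1.1 §(b)), STEP CT-3b2a: THE TWO PER-PAIR BOUNDS OF THE TWO-GAUGE ∕ DRESSED-PARTNER PAIRING — «differentiate the COARSER factor»

NOT IN PRINT; OUR PROOF ATTEMPT (row owner `b2b-balaban-gan24-p1`, gen 18; journal `CLAIMS.log` INTENT «CT-3b» l.31278).  [folklore] real analysis on `ℤ^{d+1}` over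
CT-3b1 `GAN24/StaircaseFaces` ((F1)–(F4)) and leaf-12's `EnvelopeBlockSum.env_wobble`; 0 cited facts, 0 `def`, 0 `def … : Prop`, 0 sorry.  HONEST FRAMING (cell contract,
verbatim): «discharging `BetaPertH` makes Bałaban's UV stability UNCONDITIONAL — a real constructive-QFT result; it is NOT the continuum limit and NOT the Clay problem.»
HONEST DEPENDENCY (verbatim): «continuum YM on T⁴ ⇐ BetaPertH ∧ nine spine estimates (0/9 proved); BetaPertH ⇐ (D1) ∧ (D4) ∧ CAP+tail; G-an2-4 gates asym, D1 and NE2/3/4.»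

## The object (CT3-MECHANISM v1.1 §(b))
One scale pair of the pairing `Σ'_u t_κ(u)·λ̄(κ,u)·(Δ_κ μ)(u)` of a 1-form `t` (the tent force `𝒬ᵀ_N φ` of an undressed partner leg) with ONE piece `λ` of the first gauge
staircase (read through its midpoint average `λ̄(κ,u) = ½(λ u + λ(u + e_κ))`) and ONE piece `μ` of the second (differentiated).  Envelopes: `|t_κ u| ≤ τ·E₀ u`,
`|λ u| ≤ A·E₁ u`, `|μ u| ≤ B·E₂ u`, `E_i u = e^{−κ₀‖quo N u − c_i‖∞}` constant on the `N`-blocks, `E = E₀E₁E₂` summable.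
* §2 (i) **`abs_pair_le_of_blockConst_diff`** — the DIFFERENTIATED factor is block-constant on `P`-blocks, `P ∣ N` (the coarser one): `Δ_κ μ` lives on the `P`-faces ((F1)),
  which carry exactly `P⁻¹` of the mass of `E` ((F2)) ⇒ `|pair| ≤ 2e^{2κ₀}·τAB·P⁻¹·Σ'E`.
* §3 (ii) **`abs_pair_le_of_blockConst_avg`** — the AVERAGED factor is block-constant on `P`-blocks (`P ∣ N`) and `t = 𝒬ᵀ_N φ` with `|φ κ y| ≤ Φ₀e^{−κ₀‖y − y₀‖∞}`: sum by parts
  ((F3)) onto `t·λ̄`, whose difference is (`Δt`)·`λ̄` — the tent's gradient, `≤ 2Φ₀e^{2κ₀}E₀` with NO factor `N` ((F4)) — plus `t·(Δλ̄)` on (two layers of) the `P`-faces ⇒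
  `|pair| ≤ (4e^{4κ₀}·Φ₀·AB + 4e^{4κ₀}·τAB·P⁻¹)·Σ'E`.
Module CT-3b2b `StaircasePairing` sums (i)∕(ii) over the scale pairs with the derivative always on the coarser piece: `Σ_{s₁,s₂} Lc^{−max} ·Lc^{s₁+s₂} = O(Lc^k)` — no `log N`.
Discharges NO slot letter; asserts NO shape of Bałaban's stencils; 0 wall binders; NEVER «G-an2-4 closed»; NOT D1, NOT BetaPertH, NOT continuum, NOT Clay.
-/

noncomputable section

open Finset
open scoped BigOperators
open Literature.MathematicalPhysics.QuantumFieldTheory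
open Literature.MathematicalPhysics.QuantumFieldTheory.LatticeForm (quo)
open Literature.MathematicalPhysics.QuantumFieldTheory.Balaban1983to89
open Literature.MathematicalPhysics.QuantumFieldTheory.Balaban1983to89.Beta
open B4ContourShift (supNorm supNorm_nonneg)
open B12Sec2to5 (l1 l1_nonneg)
open AffineAveraging (Form0 Form1 Site box toSite unitVec unitVec_apply dz)
open AffineReproduction (contourSumAdj)
open AveragingContours (blk)
open Summit.QuantumFields.BalabanUV.Beta.GAN24.StaircaseFaces (dz_comp_blk_eq_zero tsum_ite_dvd_eq tsum_mul_dz_eq contourSumAdj_add_unitVec_sub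
  abs_contourSumAdj_add_unitVec_sub_le env_add_unitVec_le env_sub_unitVec_le env_le_exp_mul_env_add_unitVec quo_zsmul_add_toSite_of_dvd)

namespace Summit.QuantumFields.BalabanUV.Beta.GAN24.StaircasePairs

variable {d : ℕ}

/-! ## §2 (i) The differentiated factor is the coarser one -/

section PairDiff

variable {N : ℕ} [NeZero N] {κ₀ τ A B : ℝ} {y₀ c₁ c₂ : Site (d + 1)}

/-- NOT IN PRINT; OUR PROOF ATTEMPT (CT3-MECHANISM v1.1 §(b) case (i); [folklore]).
**PAIR BOUND, DIFFERENTIATED FACTOR BLOCK-CONSTANT ON `P`-BLOCKS** (`P ∣ N`): with `|t κ u| ≤ τ·E₀ u`, `|lam u| ≤ A·E₁ u`, `|g (blk P u)| ≤ B·E₂ u` and `E = E₀E₁E₂` summable,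
`|Σ'_u t κ u · ½(lam u + lam (u+e_κ)) · (g (blk P (u+e_κ)) − g (blk P u))| ≤ 2e^{2κ₀}·τ·A·B·P⁻¹·Σ'_u E u`
— the difference lives on the `P`-faces ((F1)) which carry exactly `P⁻¹` of the mass ((F2)); the one-step wobbles cost `e^{κ₀}` each. -/
theorem abs_pair_le_of_blockConst_diff (hκ : 0 ≤ κ₀) (hτ : 0 ≤ τ) (hA : 0 ≤ A) (hB : 0 ≤ B) {P : ℕ} (hP : 1 ≤ P) (hPN : P ∣ N)
    {t : Form1 (d + 1) ℝ} {lam g : Form0 (d + 1) ℝ}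
    (ht : ∀ κ u, |t κ u| ≤ τ * Real.exp (-(κ₀ * supNorm (quo N u - y₀))))
    (hlam : ∀ u, |lam u| ≤ A * Real.exp (-(κ₀ * supNorm (quo N u - c₁))))
    (hg : ∀ u, |g (blk P u)| ≤ B * Real.exp (-(κ₀ * supNorm (quo N u - c₂))))
    (hE : Summable fun u : Site (d + 1) => Real.exp (-(κ₀ * supNorm (quo N u - y₀))) * Real.exp (-(κ₀ * supNorm (quo N u - c₁))) *
      Real.exp (-(κ₀ * supNorm (quo N u - c₂))))
    (κ : Fin (d + 1)) :
    (Summable fun u => t κ u * ((lam u + lam (u + unitVec κ)) / 2) * (g (blk P (u + unitVec κ)) - g (blk P u))) ∧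
    |∑' u, t κ u * ((lam u + lam (u + unitVec κ)) / 2) * (g (blk P (u + unitVec κ)) - g (blk P u))|
      ≤ 2 * Real.exp (2 * κ₀) * τ * A * B * ((P : ℝ))⁻¹ *
        ∑' u : Site (d + 1), Real.exp (-(κ₀ * supNorm (quo N u - y₀))) * Real.exp (-(κ₀ * supNorm (quo N u - c₁))) *
          Real.exp (-(κ₀ * supNorm (quo N u - c₂))) := by
  set E : Site (d + 1) → ℝ := fun u => Real.exp (-(κ₀ * supNorm (quo N u - y₀))) * Real.exp (-(κ₀ * supNorm (quo N u - c₁))) *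
      Real.exp (-(κ₀ * supNorm (quo N u - c₂))) with hEdef
  have hE0 : ∀ u, 0 ≤ E u := fun u => by positivity
  set K : ℝ := 2 * Real.exp (2 * κ₀) * τ * A * B with hK
  have hK0 : 0 ≤ K := by positivity
  -- pointwise: the summand is bounded by `K · (face indicator) · E`
  have hpt : ∀ u, |t κ u * ((lam u + lam (u + unitVec κ)) / 2) * (g (blk P (u + unitVec κ)) - g (blk P u))|
      ≤ K * (if (P : ℤ) ∣ u κ + 1 then E u else 0) := by
    intro u
    by_cases hf : (P : ℤ) ∣ u κ + 1
    · rw [if_pos hf]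
      have h1 := ht κ u
      have h2 : |(lam u + lam (u + unitVec κ)) / 2| ≤ A * Real.exp κ₀ * Real.exp (-(κ₀ * supNorm (quo N u - c₁))) := by
        rw [abs_div, abs_two]
        have a1 := hlam u
        have a2 := (hlam (u + unitVec κ)).trans (mul_le_mul_of_nonneg_left (env_add_unitVec_le (N := N) hκ c₁ u κ) hA)
        have a3 := abs_add_le (lam u) (lam (u + unitVec κ))
        have hx : (1 : ℝ) ≤ Real.exp κ₀ := Real.one_le_exp hκ
        have hpos : 0 ≤ A * Real.exp (-(κ₀ * supNorm (quo N u - c₁))) := by positivity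
        nlinarith
      have h3 : |g (blk P (u + unitVec κ)) - g (blk P u)| ≤ 2 * B * Real.exp κ₀ * Real.exp (-(κ₀ * supNorm (quo N u - c₂))) := by
        have a1 := hg u
        have a2 := (hg (u + unitVec κ)).trans (mul_le_mul_of_nonneg_left (env_add_unitVec_le (N := N) hκ c₂ u κ) hB)
        have a3 := abs_sub (g (blk P (u + unitVec κ))) (g (blk P u))
        have hx : (1 : ℝ) ≤ Real.exp κ₀ := Real.one_le_exp hκ
        have hpos : 0 ≤ B * Real.exp (-(κ₀ * supNorm (quo N u - c₂))) := by positivity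
        nlinarith
      rw [abs_mul, abs_mul]
      calc |t κ u| * |(lam u + lam (u + unitVec κ)) / 2| * |g (blk P (u + unitVec κ)) - g (blk P u)|
          ≤ (τ * Real.exp (-(κ₀ * supNorm (quo N u - y₀)))) * (A * Real.exp κ₀ * Real.exp (-(κ₀ * supNorm (quo N u - c₁)))) *
              (2 * B * Real.exp κ₀ * Real.exp (-(κ₀ * supNorm (quo N u - c₂)))) := by
            have := abs_nonneg (t κ u); have := abs_nonneg ((lam u + lam (u + unitVec κ)) / 2)
            exact mul_le_mul (mul_le_mul h1 h2 (abs_nonneg _) (by positivity)) h3 (abs_nonneg _) (by positivity)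
        _ = K * E u := by rw [hK, hEdef]; simp only []; rw [show (2 : ℝ) * κ₀ = κ₀ + κ₀ by ring, Real.exp_add]; ring
    · rw [if_neg hf]
      have hz : g (blk P (u + unitVec κ)) - g (blk P u) = 0 := by
        have := dz_comp_blk_eq_zero hP g hf
        simpa only [dz] using this
      rw [hz, mul_zero, abs_zero, mul_zero]
  have hmaj : Summable fun u : Site (d + 1) => K * (if (P : ℤ) ∣ u κ + 1 then E u else 0) := by
    refine (Summable.of_nonneg_of_le (fun u => ?_) (fun u => ?_) hE).mul_left K
    · split_ifs <;> [exact hE0 u; exact le_rfl]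
    · split_ifs <;> [exact le_rfl; exact hE0 u]
  have hs : Summable fun u => t κ u * ((lam u + lam (u + unitVec κ)) / 2) * (g (blk P (u + unitVec κ)) - g (blk P u)) :=
    Summable.of_norm_bounded hmaj (fun u => by rw [Real.norm_eq_abs]; exact hpt u)
  refine ⟨hs, ?_⟩
  -- sum: face fraction `P⁻¹`
  have hconst : ∀ (w : Site (d + 1)) (r : Fin (d + 1) → ℕ), r ∈ box (d + 1) P → E ((P : ℤ) • w + toSite r) = E ((P : ℤ) • w) := by
    intro w r hr
    simp only [hEdef, quo_zsmul_add_toSite_of_dvd (N := N) hP hPN w hr]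
  calc |∑' u, t κ u * ((lam u + lam (u + unitVec κ)) / 2) * (g (blk P (u + unitVec κ)) - g (blk P u))|
      ≤ ∑' u, |t κ u * ((lam u + lam (u + unitVec κ)) / 2) * (g (blk P (u + unitVec κ)) - g (blk P u))| := by
        have h := norm_tsum_le_tsum_norm hs.norm; simpa only [Real.norm_eq_abs] using h
    _ ≤ ∑' u, K * (if (P : ℤ) ∣ u κ + 1 then E u else 0) := hs.abs.tsum_le_tsum hpt hmaj
    _ = K * (((P : ℝ))⁻¹ * ∑' u, E u) := by rw [tsum_mul_left, tsum_ite_dvd_eq hP hE hconst κ]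
    _ = _ := by rw [hK]; ring

end PairDiff

/-! ## §3 (ii) The averaged factor is the coarser one: sum by parts -/

section PairAvg

variable {N : ℕ} [NeZero N] {κ₀ τ Φ₀ A B : ℝ} {y₀ c₁ c₂ : Site (d + 1)}

/-- [folklore] `e^{aκ₀}·e^{bκ₀} = e^{(a+b)κ₀}` bookkeeping: `e^{jκ₀} ≤ e^{5κ₀}` for `j ≤ 5`, `κ₀ ≥ 0`. -/
theorem exp_mul_le_exp_five_mul (hκ : 0 ≤ κ₀) {j : ℝ} (hj : j ≤ 5) : Real.exp (j * κ₀) ≤ Real.exp (5 * κ₀) :=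
  Real.exp_le_exp.2 (by nlinarith)

/-- NOT IN PRINT; OUR PROOF ATTEMPT (CT3-MECHANISM v1.1 §(b) case (ii); [folklore]).
**PAIR BOUND, AVERAGED FACTOR BLOCK-CONSTANT ON `P`-BLOCKS** (`P ∣ N`), differentiated factor ARBITRARY, `t = 𝒬ᵀ_N φ` the tent force of a coarse kernel with
`|φ κ y| ≤ Φ₀·e^{−κ₀‖y − y₀‖∞}` and `|t κ u| ≤ τ·E₀ u`: summing by parts ((F3)) puts the difference on `t·λ̄`; the tent's own gradient costs `2Φ₀e^{2κ₀}E₀` with NO factor `N`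
((F4)), the staircase's costs `P⁻¹` of the mass ((F1)+(F2), two layers):
`|Σ'_u t κ u · ½(g(blk P u) + g(blk P (u+e_κ))) · (m (u+e_κ) − m u)| ≤ 2e^{5κ₀}·(Φ₀ + τ·P⁻¹)·A·B·Σ'_u E u`. -/
theorem abs_pair_le_of_blockConst_avg (hκ : 0 ≤ κ₀) (hτ : 0 ≤ τ) (hΦ : 0 ≤ Φ₀) (hA : 0 ≤ A) (hB : 0 ≤ B) {P : ℕ} (hP : 1 ≤ P) (hPN : P ∣ N)
    {φ : Form1 (d + 1) ℝ} {g m : Form0 (d + 1) ℝ}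
    (hφ : ∀ κ y, |φ κ y| ≤ Φ₀ * Real.exp (-(κ₀ * supNorm (y - y₀))))
    (ht : ∀ κ u, |contourSumAdj N φ κ u| ≤ τ * Real.exp (-(κ₀ * supNorm (quo N u - y₀))))
    (hg : ∀ u, |g (blk P u)| ≤ A * Real.exp (-(κ₀ * supNorm (quo N u - c₁))))
    (hm : ∀ u, |m u| ≤ B * Real.exp (-(κ₀ * supNorm (quo N u - c₂))))
    (hE : Summable fun u : Site (d + 1) => Real.exp (-(κ₀ * supNorm (quo N u - y₀))) * Real.exp (-(κ₀ * supNorm (quo N u - c₁))) *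
      Real.exp (-(κ₀ * supNorm (quo N u - c₂))))
    (κ : Fin (d + 1)) :
    (Summable fun u => contourSumAdj N φ κ u * ((g (blk P u) + g (blk P (u + unitVec κ))) / 2) * (m (u + unitVec κ) - m u)) ∧
    |∑' u, contourSumAdj N φ κ u * ((g (blk P u) + g (blk P (u + unitVec κ))) / 2) * (m (u + unitVec κ) - m u)|
      ≤ 2 * Real.exp (5 * κ₀) * (Φ₀ + τ * ((P : ℝ))⁻¹) * A * B *
        ∑' u : Site (d + 1), Real.exp (-(κ₀ * supNorm (quo N u - y₀))) * Real.exp (-(κ₀ * supNorm (quo N u - c₁))) *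
          Real.exp (-(κ₀ * supNorm (quo N u - c₂))) := by
  -- names
  set E₀ : Site (d + 1) → ℝ := fun u => Real.exp (-(κ₀ * supNorm (quo N u - y₀))) with hE₀
  set E₁ : Site (d + 1) → ℝ := fun u => Real.exp (-(κ₀ * supNorm (quo N u - c₁))) with hE₁
  set E₂ : Site (d + 1) → ℝ := fun u => Real.exp (-(κ₀ * supNorm (quo N u - c₂))) with hE₂
  have hE' : Summable fun u => E₀ u * E₁ u * E₂ u := hE
  have hEnn : ∀ u, 0 ≤ E₀ u * E₁ u * E₂ u := fun u => by positivity
  have hx1 : (1 : ℝ) ≤ Real.exp κ₀ := Real.one_le_exp hκ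
  have hx0 : 0 < Real.exp κ₀ := Real.exp_pos κ₀
  set t : Form1 (d + 1) ℝ := contourSumAdj N φ with htdef
  set gbar : Site (d + 1) → ℝ := fun u => (g (blk P u) + g (blk P (u + unitVec κ))) / 2 with hgbar_def
  set Aκ : Site (d + 1) → ℝ := fun u => t κ u * gbar u with hAκ
  -- one-step envelopes of the factors
  have hgbar : ∀ u, |gbar u| ≤ A * Real.exp κ₀ * E₁ u := by
    intro u
    simp only [hgbar_def]
    rw [abs_div, abs_two]
    have a1 := hg u
    have a2 := (hg (u + unitVec κ)).trans (mul_le_mul_of_nonneg_left (env_add_unitVec_le (N := N) hκ c₁ u κ) hA)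
    have a3 := abs_add_le (g (blk P u)) (g (blk P (u + unitVec κ)))
    have hpos : 0 ≤ A * E₁ u := by positivity
    have h4 : A * E₁ u ≤ A * Real.exp κ₀ * E₁ u := by nlinarith
    simp only [hE₁] at hpos h4 a1 a2 ⊢
    linarith
  have hm' : ∀ u, |m (u + unitVec κ)| ≤ B * Real.exp κ₀ * E₂ u := fun u =>
    (hm (u + unitVec κ)).trans (by
      have := mul_le_mul_of_nonneg_left (env_add_unitVec_le (N := N) hκ c₂ u κ) hB
      simpa only [hE₂, mul_assoc] using this)
  -- summability of the two products of (F3)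
  have hs2 : Summable fun u => Aκ u * m u := by
    refine Summable.of_norm_bounded (hE'.mul_left (τ * (A * Real.exp κ₀) * B)) (fun u => ?_)
    rw [Real.norm_eq_abs, abs_mul, hAκ]; dsimp only
    rw [abs_mul]
    calc |t κ u| * |gbar u| * |m u| ≤ (τ * E₀ u) * (A * Real.exp κ₀ * E₁ u) * (B * E₂ u) :=
          mul_le_mul (mul_le_mul (ht κ u) (hgbar u) (abs_nonneg _) (by positivity)) (hm u) (abs_nonneg _) (by positivity)
      _ = τ * (A * Real.exp κ₀) * B * (E₀ u * E₁ u * E₂ u) := by ring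
  have hs1 : Summable fun u => Aκ u * m (u + unitVec κ) := by
    refine Summable.of_norm_bounded (hE'.mul_left (τ * (A * Real.exp κ₀) * (B * Real.exp κ₀))) (fun u => ?_)
    rw [Real.norm_eq_abs, abs_mul, hAκ]; dsimp only
    rw [abs_mul]
    calc |t κ u| * |gbar u| * |m (u + unitVec κ)| ≤ (τ * E₀ u) * (A * Real.exp κ₀ * E₁ u) * (B * Real.exp κ₀ * E₂ u) :=
          mul_le_mul (mul_le_mul (ht κ u) (hgbar u) (abs_nonneg _) (by positivity)) (hm' u) (abs_nonneg _) (by positivity)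
      _ = τ * (A * Real.exp κ₀) * (B * Real.exp κ₀) * (E₀ u * E₁ u * E₂ u) := by ring
  have hs : Summable fun u => t κ u * gbar u * (m (u + unitVec κ) - m u) := by
    have h := hs1.sub hs2
    have e : (fun u => Aκ u * m (u + unitVec κ) - Aκ u * m u) = fun u => t κ u * gbar u * (m (u + unitVec κ) - m u) := by
      funext u; simp only [hAκ]; ring
    rwa [e] at h
  refine ⟨hs, ?_⟩
  -- (F3)
  rw [show (∑' u, t κ u * gbar u * (m (u + unitVec κ) - m u)) = ∑' u, Aκ u * (m (u + unitVec κ) - m u) from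
    tsum_congr fun u => by simp only [hAκ], tsum_mul_dz_eq Aκ m κ hs1 hs2]
  -- pointwise bound of the by-parts summand
  have hu : ∀ u : Site (d + 1), u - unitVec κ + unitVec κ = u := fun u => sub_add_cancel u (unitVec κ)
  have esplit : ∀ u, Aκ (u - unitVec κ) - Aκ u
      = (t κ (u - unitVec κ) - t κ u) * gbar (u - unitVec κ) + t κ u * (gbar (u - unitVec κ) - gbar u) := by
    intro u; simp only [hAκ]; ring
  -- the tent gradient (F4), read at `u − e_κ`, envelope moved to `u`
  have hdt : ∀ u, |t κ (u - unitVec κ) - t κ u| ≤ 2 * Φ₀ * Real.exp (2 * κ₀) * (Real.exp κ₀ * E₀ u) := by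
    intro u
    have h := abs_contourSumAdj_add_unitVec_sub_le (N := N) hΦ hκ y₀ hφ κ (u - unitVec κ)
    rw [hu, abs_sub_comm] at h
    exact h.trans (mul_le_mul_of_nonneg_left (env_sub_unitVec_le (N := N) hκ y₀ u κ) (by positivity))
  have hgbar' : ∀ u, |gbar (u - unitVec κ)| ≤ A * Real.exp κ₀ * (Real.exp κ₀ * E₁ u) := fun u =>
    (hgbar (u - unitVec κ)).trans (mul_le_mul_of_nonneg_left (env_sub_unitVec_le (N := N) hκ c₁ u κ) (by positivity))
  -- the staircase difference over two steps: faces at `u` and at `u − e_κ`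
  set I₁ : Site (d + 1) → ℝ := fun u => if (P : ℤ) ∣ u κ + 1 then 1 else 0 with hI₁
  set I₂ : Site (d + 1) → ℝ := fun u => if (P : ℤ) ∣ (u - unitVec κ) κ + 1 then 1 else 0 with hI₂
  have hI₁0 : ∀ u, 0 ≤ I₁ u := fun u => by simp only [hI₁]; split_ifs <;> norm_num
  have hI₂0 : ∀ u, 0 ≤ I₂ u := fun u => by simp only [hI₂]; split_ifs <;> norm_num
  have hstep1 : ∀ u, |g (blk P (u + unitVec κ)) - g (blk P u)| ≤ 2 * A * Real.exp κ₀ * E₁ u * I₁ u := by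
    intro u
    simp only [hI₁]
    by_cases hf : (P : ℤ) ∣ u κ + 1
    · rw [if_pos hf, mul_one]
      have a1 := hg u
      have a2 := (hg (u + unitVec κ)).trans (mul_le_mul_of_nonneg_left (env_add_unitVec_le (N := N) hκ c₁ u κ) hA)
      have a3 := abs_sub (g (blk P (u + unitVec κ))) (g (blk P u))
      have hpos : 0 ≤ A * E₁ u := by positivity
      have h4 : A * E₁ u ≤ A * Real.exp κ₀ * E₁ u := by nlinarith
      simp only [hE₁] at hpos h4 a1 a2 ⊢
      linarith
    · rw [if_neg hf, mul_zero]
      have := dz_comp_blk_eq_zero hP g hf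
      simp only [dz] at this
      rw [this, abs_zero]
  have hstep2 : ∀ u, |g (blk P u) - g (blk P (u - unitVec κ))| ≤ 2 * A * Real.exp κ₀ * E₁ u * I₂ u := by
    intro u
    simp only [hI₂]
    by_cases hf : (P : ℤ) ∣ (u - unitVec κ) κ + 1
    · rw [if_pos hf, mul_one]
      have a1 := hg u
      have a2 := (hg (u - unitVec κ)).trans (mul_le_mul_of_nonneg_left (env_sub_unitVec_le (N := N) hκ c₁ u κ) hA)
      have a3 := abs_sub (g (blk P u)) (g (blk P (u - unitVec κ)))
      have hpos : 0 ≤ A * E₁ u := by positivity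
      have h4 : A * E₁ u ≤ A * Real.exp κ₀ * E₁ u := by nlinarith
      simp only [hE₁] at hpos h4 a1 a2 ⊢
      linarith
    · rw [if_neg hf, mul_zero]
      have := dz_comp_blk_eq_zero hP g hf
      simp only [dz, hu] at this
      rw [this, abs_zero]
  have hdg : ∀ u, |gbar (u - unitVec κ) - gbar u| ≤ A * Real.exp κ₀ * E₁ u * (I₁ u + I₂ u) := by
    intro u
    have e : gbar (u - unitVec κ) - gbar u = -((g (blk P (u + unitVec κ)) - g (blk P u)) + (g (blk P u) - g (blk P (u - unitVec κ)))) / 2 := by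
      simp only [hgbar_def, hu]; ring
    rw [e, abs_div, abs_neg, abs_two]
    have a3 := abs_add_le (g (blk P (u + unitVec κ)) - g (blk P u)) (g (blk P u) - g (blk P (u - unitVec κ)))
    have b1 := hstep1 u
    have b2 := hstep2 u
    have := hI₁0 u; have := hI₂0 u
    have hpos : 0 ≤ A * Real.exp κ₀ * E₁ u := by positivity
    rw [div_le_iff₀ (by norm_num : (0:ℝ) < 2)]
    nlinarith
  -- pointwise majorant
  set K₁ : ℝ := 2 * Φ₀ * A * B * (Real.exp (2 * κ₀) * Real.exp κ₀ * Real.exp κ₀ * Real.exp κ₀) with hK₁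
  set K₂ : ℝ := τ * A * B * Real.exp κ₀ with hK₂
  have hK₁0 : 0 ≤ K₁ := by positivity
  have hK₂0 : 0 ≤ K₂ := by positivity
  have hpt : ∀ u, |m u * (Aκ (u - unitVec κ) - Aκ u)|
      ≤ K₁ * (E₀ u * E₁ u * E₂ u) + K₂ * ((E₀ u * E₁ u * E₂ u) * I₁ u) + K₂ * ((E₀ u * E₁ u * E₂ u) * I₂ u) := by
    intro u
    rw [abs_mul, esplit u]
    have hX : |(t κ (u - unitVec κ) - t κ u) * gbar (u - unitVec κ)|
        ≤ (2 * Φ₀ * Real.exp (2 * κ₀) * (Real.exp κ₀ * E₀ u)) * (A * Real.exp κ₀ * (Real.exp κ₀ * E₁ u)) := by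
      rw [abs_mul]; exact mul_le_mul (hdt u) (hgbar' u) (abs_nonneg _) (by positivity)
    have hY : |t κ u * (gbar (u - unitVec κ) - gbar u)| ≤ (τ * E₀ u) * (A * Real.exp κ₀ * E₁ u * (I₁ u + I₂ u)) := by
      rw [abs_mul]; exact mul_le_mul (ht κ u) (hdg u) (abs_nonneg _) (by positivity)
    have hXY := (abs_add_le _ _).trans (add_le_add hX hY)
    calc |m u| * |(t κ (u - unitVec κ) - t κ u) * gbar (u - unitVec κ) + t κ u * (gbar (u - unitVec κ) - gbar u)|
        ≤ (B * E₂ u) * ((2 * Φ₀ * Real.exp (2 * κ₀) * (Real.exp κ₀ * E₀ u)) * (A * Real.exp κ₀ * (Real.exp κ₀ * E₁ u))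
            + (τ * E₀ u) * (A * Real.exp κ₀ * E₁ u * (I₁ u + I₂ u))) :=
          mul_le_mul (hm u) hXY (abs_nonneg _) (by positivity)
      _ = K₁ * (E₀ u * E₁ u * E₂ u) + K₂ * ((E₀ u * E₁ u * E₂ u) * I₁ u) + K₂ * ((E₀ u * E₁ u * E₂ u) * I₂ u) := by
          rw [hK₁, hK₂]; ring
  -- the three sums
  have hconst : ∀ (w : Site (d + 1)) (r : Fin (d + 1) → ℕ), r ∈ box (d + 1) P →
      (fun u => E₀ u * E₁ u * E₂ u) ((P : ℤ) • w + toSite r) = (fun u => E₀ u * E₁ u * E₂ u) ((P : ℤ) • w) := by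
    intro w r hr; simp only [hE₀, hE₁, hE₂, quo_zsmul_add_toSite_of_dvd (N := N) hP hPN w hr]
  have eI₁ : (fun u => (E₀ u * E₁ u * E₂ u) * I₁ u) = fun u => if (P : ℤ) ∣ u κ + 1 then E₀ u * E₁ u * E₂ u else 0 := by
    funext u; simp only [hI₁]; split_ifs <;> simp
  have hF1 : Summable fun u => (E₀ u * E₁ u * E₂ u) * I₁ u := by
    rw [eI₁]
    exact Summable.of_nonneg_of_le (fun u => by split_ifs <;> [exact hEnn u; exact le_rfl])
      (fun u => by split_ifs <;> [exact le_rfl; exact hEnn u]) hE'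
  have hF1sum : ∑' u, (E₀ u * E₁ u * E₂ u) * I₁ u = ((P : ℝ))⁻¹ * ∑' u, E₀ u * E₁ u * E₂ u := by
    rw [eI₁]; exact tsum_ite_dvd_eq hP hE' hconst κ
  -- the shifted face layer: shift the index and wobble the envelope by three steps
  have hshiftE : ∀ v, E₀ (v + unitVec κ) * E₁ (v + unitVec κ) * E₂ (v + unitVec κ)
      ≤ (Real.exp κ₀ * Real.exp κ₀ * Real.exp κ₀) * (E₀ v * E₁ v * E₂ v) := by
    intro v
    have h0 := env_add_unitVec_le (N := N) hκ y₀ v κ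
    have h1 := env_add_unitVec_le (N := N) hκ c₁ v κ
    have h2 := env_add_unitVec_le (N := N) hκ c₂ v κ
    simp only [hE₀, hE₁, hE₂] at h0 h1 h2 ⊢
    calc _ ≤ (Real.exp κ₀ * Real.exp (-(κ₀ * supNorm (quo N v - y₀)))) * (Real.exp κ₀ * Real.exp (-(κ₀ * supNorm (quo N v - c₁)))) *
          (Real.exp κ₀ * Real.exp (-(κ₀ * supNorm (quo N v - c₂)))) :=
          mul_le_mul (mul_le_mul h0 h1 (by positivity) (by positivity)) h2 (by positivity) (by positivity)
      _ = _ := by ring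
  set G : Site (d + 1) → ℝ := fun v =>
      if (P : ℤ) ∣ v κ + 1 then E₀ (v + unitVec κ) * E₁ (v + unitVec κ) * E₂ (v + unitVec κ) else 0 with hGdef
  have eI₂ : (fun u => (E₀ u * E₁ u * E₂ u) * I₂ u) = fun u => G (Equiv.subRight (unitVec κ) u) := by
    funext u; simp only [hI₂, hGdef, Equiv.subRight_apply, sub_add_cancel]; split_ifs <;> simp
  have hGle : ∀ v, G v ≤ (Real.exp κ₀ * Real.exp κ₀ * Real.exp κ₀) * (if (P : ℤ) ∣ v κ + 1 then E₀ v * E₁ v * E₂ v else 0) := by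
    intro v
    simp only [hGdef]
    split_ifs
    · exact hshiftE v
    · simp
  have hG0 : ∀ v, 0 ≤ G v := fun v => by simp only [hGdef]; split_ifs <;> [positivity; exact le_rfl]
  have hGmaj : Summable fun v : Site (d + 1) =>
      (Real.exp κ₀ * Real.exp κ₀ * Real.exp κ₀) * (if (P : ℤ) ∣ v κ + 1 then E₀ v * E₁ v * E₂ v else 0) :=
    (hF1.mul_left (Real.exp κ₀ * Real.exp κ₀ * Real.exp κ₀)).congr fun v => by
      simp only [hI₁]; split_ifs <;> simp
  have hG : Summable G := Summable.of_nonneg_of_le hG0 hGle hGmaj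
  have hF2 : Summable fun u => (E₀ u * E₁ u * E₂ u) * I₂ u := by
    rw [eI₂]; exact (Equiv.summable_iff (Equiv.subRight (unitVec κ)) (f := G)).2 hG
  have hT2 : ∑' u, (E₀ u * E₁ u * E₂ u) * I₂ u = ∑' v, G v := by
    rw [eI₂]; exact Equiv.tsum_eq (Equiv.subRight (unitVec κ)) G
  have hF2sum : ∑' u, (E₀ u * E₁ u * E₂ u) * I₂ u ≤ (Real.exp κ₀ * Real.exp κ₀ * Real.exp κ₀) * (((P : ℝ))⁻¹ * ∑' u, E₀ u * E₁ u * E₂ u) := by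
    rw [hT2, ← tsum_ite_dvd_eq hP hE' hconst κ, ← tsum_mul_left]
    exact hG.tsum_le_tsum hGle hGmaj
  have hmaj : Summable fun u => K₁ * (E₀ u * E₁ u * E₂ u) + K₂ * ((E₀ u * E₁ u * E₂ u) * I₁ u) + K₂ * ((E₀ u * E₁ u * E₂ u) * I₂ u) :=
    ((hE'.mul_left K₁).add (hF1.mul_left K₂)).add (hF2.mul_left K₂)
  have hsm : Summable fun u => m u * (Aκ (u - unitVec κ) - Aκ u) :=
    Summable.of_norm_bounded hmaj (fun u => by rw [Real.norm_eq_abs]; exact hpt u)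
  -- constants: every `e^{jκ₀}`, `j ≤ 5`, is `≤ e^{5κ₀}`
  have e4 : Real.exp (2 * κ₀) * Real.exp κ₀ * Real.exp κ₀ * Real.exp κ₀ = Real.exp (5 * κ₀) := by
    rw [← Real.exp_add, ← Real.exp_add, ← Real.exp_add]; ring_nf
  have e3 : Real.exp κ₀ * (Real.exp κ₀ * Real.exp κ₀ * Real.exp κ₀) = Real.exp (4 * κ₀) := by
    rw [← Real.exp_add, ← Real.exp_add, ← Real.exp_add]; ring_nf
  have h15 : Real.exp κ₀ ≤ Real.exp (5 * κ₀) := by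
    have := exp_mul_le_exp_five_mul hκ (j := 1) (by norm_num); rwa [one_mul] at this
  have h45 : Real.exp (4 * κ₀) ≤ Real.exp (5 * κ₀) := exp_mul_le_exp_five_mul hκ (by norm_num)
  have hS0 : 0 ≤ ∑' u, E₀ u * E₁ u * E₂ u := tsum_nonneg hEnn
  have hPinv : 0 ≤ ((P : ℝ))⁻¹ := by positivity
  calc |∑' u, m u * (Aκ (u - unitVec κ) - Aκ u)| ≤ ∑' u, |m u * (Aκ (u - unitVec κ) - Aκ u)| := by
        have h := norm_tsum_le_tsum_norm hsm.norm; simpa only [Real.norm_eq_abs] using h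
    _ ≤ ∑' u, (K₁ * (E₀ u * E₁ u * E₂ u) + K₂ * ((E₀ u * E₁ u * E₂ u) * I₁ u) + K₂ * ((E₀ u * E₁ u * E₂ u) * I₂ u)) :=
        hsm.abs.tsum_le_tsum hpt hmaj
    _ = K₁ * ∑' u, E₀ u * E₁ u * E₂ u + K₂ * ∑' u, (E₀ u * E₁ u * E₂ u) * I₁ u + K₂ * ∑' u, (E₀ u * E₁ u * E₂ u) * I₂ u := by
        rw [((hE'.mul_left K₁).add (hF1.mul_left K₂)).tsum_add (hF2.mul_left K₂), (hE'.mul_left K₁).tsum_add (hF1.mul_left K₂),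
          tsum_mul_left, tsum_mul_left, tsum_mul_left]
    _ ≤ K₁ * ∑' u, E₀ u * E₁ u * E₂ u + K₂ * (((P : ℝ))⁻¹ * ∑' u, E₀ u * E₁ u * E₂ u)
          + K₂ * ((Real.exp κ₀ * Real.exp κ₀ * Real.exp κ₀) * (((P : ℝ))⁻¹ * ∑' u, E₀ u * E₁ u * E₂ u)) := by
        rw [hF1sum]; gcongr
    _ = (K₁ + (K₂ + K₂ * (Real.exp κ₀ * Real.exp κ₀ * Real.exp κ₀)) * ((P : ℝ))⁻¹) * ∑' u, E₀ u * E₁ u * E₂ u := by ring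
    _ ≤ 2 * Real.exp (5 * κ₀) * (Φ₀ + τ * ((P : ℝ))⁻¹) * A * B * ∑' u, E₀ u * E₁ u * E₂ u := by
        refine mul_le_mul_of_nonneg_right ?_ hS0
        have hc1 : K₁ = 2 * Φ₀ * A * B * Real.exp (5 * κ₀) := by rw [hK₁, e4]
        have hc2 : K₂ + K₂ * (Real.exp κ₀ * Real.exp κ₀ * Real.exp κ₀) = τ * A * B * (Real.exp κ₀ + Real.exp (4 * κ₀)) := by
          rw [hK₂, ← e3]; ring
        rw [hc1, hc2]
        have hτAB : 0 ≤ τ * A * B := by positivity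
        have hsum5 : Real.exp κ₀ + Real.exp (4 * κ₀) ≤ 2 * Real.exp (5 * κ₀) := by linarith
        nlinarith [mul_le_mul_of_nonneg_left hsum5 (mul_nonneg hτAB hPinv), mul_nonneg (mul_nonneg (mul_nonneg hΦ hA) hB) (Real.exp_pos (5 * κ₀)).le]

end PairAvg

end Summit.QuantumFields.BalabanUV.Beta.GAN24.StaircasePairs

end
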